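import Summits.QuantumFields.YangMills.Theorems.BalabanUVNodesN21SelectedThresholds
import Summits.QuantumFields.YangMills.Theorems.BalabanUVNodesN21SelectedThresholdsTransport

/-!
# YM-DAG node N21 (= NE7c) — ROW A‴: ROAD I AT SELECTED THRESHOLDS WITH THE PUSHES DISCHARGED FROM TRANSPORT DATA — 18b's two level ledgers,
# its `ShellWeightBound` and the K5 stub, the four push binders `hpushA∕B`, `htotalA∕B` REPLACED by a t-free state law, its tilted twins, ONE sandwich
# constant `C` and the transported masses (`M₁ = C`, `M₂ = C⁻¹`; lens `LENS-nearmiss.md` v5.0 §4 ROW A‴ binder shapes verbatim)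

Track A of `YM-PLAN.md` (cell `pub-ymgap`, HUMAN RULING D-0062), node **N21**; R134 fan-out seat `pub-ymgap-dag-n21-d` (s2), generation 5, module 20c.  THEOREMS ONLY:
0 `def`, 0 `sorry`, standard axioms; COUNT-NEUTRAL; `--supports` the K3‴ item `SpineGivenEndpointR13` (stmt-QuantumFields-19912) as a helper.  `N`-generic, NO Theses
import, NO `Node00.Record13` import.  Imports module 18b `BalabanUVNodesN21SelectedThresholds` (p485209: `levelLedgers_of_selectedThresholds`,
`shellWeightBound_geometric_of_selectedThresholds`, `levelLedger_of_goodAssignment`, `levelConst_le`) and module 20b `BalabanUVNodesN21SelectedThresholdsTransport`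
(lens g5 sketch verbatim: `pushes_of_sandwich`; `hdep_of_restrict` is the device discharging `hdep` when the state law is GIVEN as a function of the older thresholds).

THE POINT (lens Cards 11–13, ROW A‴).  Module 18b's wall after ROW A″ = its displayed binders: older-measurable `t`-free laws (`hdep`), the pushes `hpushA∕B`,
`htotalA∕B` with losses `M₁∕M₂` («(R)+(PD), lens Card 8 — E-class» in 18b's framing), `hcard`, the box.  The lens's print audit (module 20b's header; this seat's
(K8-i) read, module 20's header) re-classifies the pushes as MASS TRANSPORT: every younger operation of print is positive, LINEAR and total-mass preserving on
lineage densities, so with `ν₀ K a s :=` the run's bookkeeping STATE LAW at the start of the slot's step (untilted) and `νt K a t s` its tilted twin —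
sandwiched `νt ≤ C•ν₀`, `ν₀ ≤ C•νt` with ONE `C = e^{l₀·n̄}` uniformly in the number of steps (20b §B) — the slot's `ℝ≥0∞` pieces `m K a t s τ` summed over the
final terms are AT MOST `νt(shell)` and the `ℝ≥0∞` weights sum to EXACTLY `νt(univ)` (20b §A, (0.4)); 20b §B′ `pushes_of_sandwich` turns these into 18b's
`hpush`∕`htotal` with `M₁ = C.toReal`, `M₂ = C⁻¹.toReal`.  HERE: §1 `levelLedgers_of_selectedThresholds_of_transport` = 18b's two ledgers with the four push
binders REPLACED by that transport data (the real letters of 18b are the `toReal`s), `D_j = (C.toReal∕C⁻¹.toReal)·F̄∕((1 − ρ_j)κ_j)`; §2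
`shellWeightBound_geometric_of_transport` (road I's `ShellWeightBound … (C′·ϑ^K)`); §3 the K5 stub `s_N21_of_selectedTransportReading` for readings pinning
bundles whose carriers ARE the transported masses READ AT a selected admissible assignment.  Module 20 (p491967) is the sibling junction in the cell's
HISTORY-INDEXED currency (`ShellMeasureRootCompositionHistories`: there the (R) facts are theorems too and the envelope `partialLaw ≤ M₁ • law` is the sandwich's
upper half); this file keeps 18b's abstract (R) letters `shA∕shB` and is the LINEAGE (kernel) currency of lens (t-n″).

HONEST FRAMING (binding).  DISPLAYED, not discharged: NODE O's threshold-parametric term object WITH ITS LINEAGE STRUCTURE — per slot the start-of-step state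
laws `ν₀ K a s` (older-measurable: `hdep`, = causality, 20b `hdep_of_restrict`), the tilted twins `νt K a t s`, the sandwich constant `C` (Card 13: a level-0
density bounded by `e^{±l₀n̄}` under a `t`-independent scheme), the transported `ℝ≥0∞` pieces∕weights with `hpieceT` (≤ `νt(shell)`, 20b §A's
`sum_lineageMass_le` once the younger steps are typed as kernels + partitions of unity) and `htotT` (= `νt(univ)`, 20b §A's `sum_lineageMass_eq`, (NO-DROP));
the (R) facts `hRA∕hRB`; `hcard`∕N20's window; the admissible box (print's finite list of cross-step relative rooms `≥ κ_adm`, lens Card 12 — (L1-step)∕U2's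
concrete target); N16's rate.  STRUCTURAL inputs, nothing analytic; nothing of Bałaban's asserted or instantiated; (M1) for print's FIXED printed thresholds
untouched; NE7c is NOT PRINTED and NOT PROVED; **N21 is NOT discharged**; typed 28∕28, discharged count untouched; one finite four-torus programme at fixed `ε` —
NOT ℝ⁴, NOT infinite volume, NOT OS, NOT a mass gap, NOT Clay.  No decl below carries a cite tag ([folklore] bookkeeping).
-/

set_option autoImplicit false

noncomputable section

open scoped BigOperators ENNReal
open MeasureTheory Set

namespace Summit.QuantumFields.YangMills.Theorems.N21SelectedThresholdsTransportLedgers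

open Literature.MathematicalPhysics.QuantumFieldTheory.Balaban1983to89
open Literature.MathematicalPhysics.QuantumFieldTheory.Balaban1983to89.T4ShellMeasure (SlotAntiConcentration)
open T4IndicatorShell (ShellWeightBound)
open T4ShellMeasureLevels (LevelLedger LiveWindow)
open YMDAG.UVSplit (SpineCarriers SpineRecordPred S_N21)
open N21SelectedThresholds (levelLedgers_of_selectedThresholds shellWeightBound_geometric_of_selectedThresholds levelLedger_of_goodAssignment
  levelConst_le)
open N21SelectedThresholdsTransport (pushes_of_sandwich)

/-- the two junction constants are a legitimate loss pair: `0 ≤ C.toReal` and `0 < C⁻¹.toReal` for `C ≠ 0, ⊤`. [folklore] -/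
theorem lossPair_of_ne (C : ℝ≥0∞) (hC : C ≠ ⊤) (hC0 : C ≠ 0) : 0 ≤ C.toReal ∧ 0 < C⁻¹.toReal :=
  ⟨ENNReal.toReal_nonneg, ENNReal.toReal_pos (ENNReal.inv_ne_zero.2 hC) (ENNReal.inv_ne_top.2 hC0)⟩

/-! ## §1 18b's two level ledgers with the push binders discharged from transport data -/

section PerComparison

variable {ι σ : Type*} [DecidableEq σ] {X : ℕ → σ → Type*} [∀ K s, MeasurableSpace (X K s)]
  {SA SB : ℕ → Finset σ} {lvl : ℕ → σ → ℕ}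
  {ν₀ : ∀ K : ℕ, (ℕ → ℝ) → ∀ s : σ, Measure (X K s)} [∀ K a s, IsFiniteMeasure (ν₀ K a s)]
  {νt : ∀ K : ℕ, (ℕ → ℝ) → ℝ → ∀ s : σ, Measure (X K s)} [∀ K a t s, IsFiniteMeasure (νt K a t s)]
  {w : ∀ (K : ℕ) (s : σ), X K s → ℝ} {θ κ ρ : ℕ → ℝ} {Fbar : ℝ} {l₀ : ℝ} {T : ℕ → Finset ι} {C : ℝ≥0∞}
  {A' B' : ℕ → (ℕ → ℝ) → ℝ → ι → ℝ≥0∞} {shA shB : ℕ → (ℕ → ℝ) → ℝ → ι → ℝ} {mA mB : ℕ → (ℕ → ℝ) → ℝ → σ → ι → ℝ≥0∞}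

/-- **ROW A‴ — BOTH LEVEL LEDGERS AT THE SAME SELECTED THRESHOLDS, PUSHES FROM TRANSPORT.**  DATA as in 18b's `levelLedgers_of_selectedThresholds` (slots of both
runs on one index type `σ`, levels `lvl K s ≤ K`, spaces `X K s`, `t`-free measurable statistics `w K s`, windows `[(1 − κ_j)θ_j, θ_j]`, widths `0 ≤ ρ_j < 1`, at most
`F̄` slots per level), but with the TRANSPORT DATA of lens ROW A‴ in place of the four push binders: per slot the `t`-free finite STATE LAW `ν₀ K a s` (fed to 18b as
its `ν`; older-measurable, `hdep`), the TILTED finite laws `νt K a t s`, ONE constant `C : ℝ≥0∞`, `C ≠ 0, ⊤` (print: `ENNReal.ofReal (exp (l₀·n̄))`), the SANDWICH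
`νt ≤ C•ν₀ ∧ ν₀ ≤ C•νt` for `|t| ≤ l₀` and admissible `a`, `ℝ≥0∞` pieces `m K a t s τ` with `hpieceT : Σ_τ m ≤ νt K a t s (shell)` and `ℝ≥0∞` weights `A′ K a t τ`
with `htotT : Σ_τ A′ = νt K a t s univ`; the real letters of 18b are the `toReal`s; the (R) facts `hRA∕hRB` for the shell letters `shA∕shB` stay as in 18b.
CONCLUSION: ONE admissible assignment `a K` per comparison at which BOTH runs' `LevelLedger`s hold with `D j = (C.toReal∕C⁻¹.toReal)·F̄∕((1 − ρ_j)κ_j)` —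
18b's `levelLedgers_of_selectedThresholds` with `hpush`∕`htotal` := 20b's `pushes_of_sandwich` (`M₁ = C.toReal`, `M₂ = C⁻¹.toReal`). [folklore] -/
theorem levelLedgers_of_selectedThresholds_of_transport
    (hw : ∀ K s, Measurable (w K s)) (hθ : ∀ j, 0 < θ j) (hκ : ∀ j, 0 < κ j ∧ κ j ≤ 1) (hρ : ∀ j, 0 ≤ ρ j ∧ ρ j < 1)
    (hdep : ∀ (K : ℕ) (s : σ) (a b : ℕ → ℝ), (∀ i, i < lvl K s → a i = b i) → ν₀ K a s = ν₀ K b s)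
    (hFbar : 0 ≤ Fbar) (hcard : ∀ K m, ((((SA K ∪ SB K).filter fun s => lvl K s = m).card : ℕ) : ℝ) ≤ Fbar)
    (hle : ∀ K, ∀ s ∈ SA K ∪ SB K, lvl K s ≤ K) (hC : C ≠ ⊤) (hC0 : C ≠ 0)
    (hsand : ∀ (K : ℕ) (a : ℕ → ℝ), (∀ j, a j ∈ Icc ((1 - κ j) * θ j) (θ j)) → ∀ t, |t| ≤ l₀ → ∀ s ∈ SA K ∪ SB K,
      νt K a t s ≤ C • ν₀ K a s ∧ ν₀ K a s ≤ C • νt K a t s)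
    (hRA : ∀ (K : ℕ) (a : ℕ → ℝ), (∀ j, a j ∈ Icc ((1 - κ j) * θ j) (θ j)) → ∀ t, |t| ≤ l₀ → ∀ τ ∈ T K,
      0 ≤ shA K a t τ ∧ shA K a t τ ≤ (A' K a t τ).toReal ∧ shA K a t τ ≤ ∑ s ∈ SA K, (mA K a t s τ).toReal)
    (hpieceTA : ∀ (K : ℕ) (a : ℕ → ℝ), (∀ j, a j ∈ Icc ((1 - κ j) * θ j) (θ j)) → ∀ t, |t| ≤ l₀ → ∀ s ∈ SA K,
      ∑ τ ∈ T K, mA K a t s τ ≤ νt K a t s {x | a (lvl K s) * (1 - ρ (lvl K s)) ≤ w K s x ∧ w K s x < a (lvl K s)})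
    (htotTA : ∀ (K : ℕ) (a : ℕ → ℝ), (∀ j, a j ∈ Icc ((1 - κ j) * θ j) (θ j)) → ∀ t, |t| ≤ l₀ → ∀ s ∈ SA K,
      ∑ τ ∈ T K, A' K a t τ = νt K a t s univ)
    (hRB : ∀ (K : ℕ) (a : ℕ → ℝ), (∀ j, a j ∈ Icc ((1 - κ j) * θ j) (θ j)) → ∀ t, |t| ≤ l₀ → ∀ τ ∈ T K,
      0 ≤ shB K a t τ ∧ shB K a t τ ≤ (B' K a t τ).toReal ∧ shB K a t τ ≤ ∑ s ∈ SB K, (mB K a t s τ).toReal)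
    (hpieceTB : ∀ (K : ℕ) (a : ℕ → ℝ), (∀ j, a j ∈ Icc ((1 - κ j) * θ j) (θ j)) → ∀ t, |t| ≤ l₀ → ∀ s ∈ SB K,
      ∑ τ ∈ T K, mB K a t s τ ≤ νt K a t s {x | a (lvl K s) * (1 - ρ (lvl K s)) ≤ w K s x ∧ w K s x < a (lvl K s)})
    (htotTB : ∀ (K : ℕ) (a : ℕ → ℝ), (∀ j, a j ∈ Icc ((1 - κ j) * θ j) (θ j)) → ∀ t, |t| ≤ l₀ → ∀ s ∈ SB K,
      ∑ τ ∈ T K, B' K a t τ = νt K a t s univ) :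
    ∃ a : ℕ → ℕ → ℝ, (∀ K j, a K j ∈ Icc ((1 - κ j) * θ j) (θ j)) ∧
      LevelLedger l₀ T (fun K t τ => (A' K (a K) t τ).toReal) (fun K => shA K (a K)) SA (fun K t s τ => (mA K (a K) t s τ).toReal) lvl
        (fun j => C.toReal / C⁻¹.toReal * (Fbar / ((1 - ρ j) * κ j))) ρ ∧
      LevelLedger l₀ T (fun K t τ => (B' K (a K) t τ).toReal) (fun K => shB K (a K)) SB (fun K t s τ => (mB K (a K) t s τ).toReal) lvl
        (fun j => C.toReal / C⁻¹.toReal * (Fbar / ((1 - ρ j) * κ j))) ρ := by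
  obtain ⟨hM₁, hM₂⟩ := lossPair_of_ne C hC hC0
  obtain ⟨a, hadm, hLA, hLB⟩ := levelLedgers_of_selectedThresholds (ν := ν₀) (A := fun K a t τ => (A' K a t τ).toReal)
    (B := fun K a t τ => (B' K a t τ).toReal) (shA := shA) (shB := shB) (pieceA := fun K a t s τ => (mA K a t s τ).toReal)
    (pieceB := fun K a t s τ => (mB K a t s τ).toReal) (M₁ := C.toReal) (M₂ := C⁻¹.toReal)
    hw hθ hκ hρ hdep hFbar hcard hle hM₁ hM₂ hRA
    (fun K a ha t ht s hs =>
      (pushes_of_sandwich (T K) (ν₀ K a s) (νt K a t s) hC hC0 (hsand K a ha t ht s (Finset.mem_union_left _ hs)).1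
        (hsand K a ha t ht s (Finset.mem_union_left _ hs)).2 (mA K a t s) (A' K a t) _ (hpieceTA K a ha t ht s hs) (htotTA K a ha t ht s hs)).1)
    (fun K a ha t ht s hs =>
      (pushes_of_sandwich (T K) (ν₀ K a s) (νt K a t s) hC hC0 (hsand K a ha t ht s (Finset.mem_union_left _ hs)).1
        (hsand K a ha t ht s (Finset.mem_union_left _ hs)).2 (mA K a t s) (A' K a t) _ (hpieceTA K a ha t ht s hs) (htotTA K a ha t ht s hs)).2)
    hRB
    (fun K a ha t ht s hs =>
      (pushes_of_sandwich (T K) (ν₀ K a s) (νt K a t s) hC hC0 (hsand K a ha t ht s (Finset.mem_union_right _ hs)).1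
        (hsand K a ha t ht s (Finset.mem_union_right _ hs)).2 (mB K a t s) (B' K a t) _ (hpieceTB K a ha t ht s hs) (htotTB K a ha t ht s hs)).1)
    (fun K a ha t ht s hs =>
      (pushes_of_sandwich (T K) (ν₀ K a s) (νt K a t s) hC hC0 (hsand K a ha t ht s (Finset.mem_union_right _ hs)).1
        (hsand K a ha t ht s (Finset.mem_union_right _ hs)).2 (mB K a t s) (B' K a t) _ (hpieceTB K a ha t ht s hs) (htotTB K a ha t ht s hs)).2)
  exact ⟨a, hadm, hLA, hLB⟩

/-! ## §2 Road I's `ShellWeightBound` at the selected thresholds, pushes from transport -/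

/-- **N21's ROAD I AT SELECTED THRESHOLDS, PUSHES FROM TRANSPORT.**  The data of §1 with N20's live windows `(N₁, ν̄)` for both slot families (in place of `hle`) +
`0 < κ_min ≤ κ_j` + `ρ_j ≤ ½` + N16's rate `0 < ϑ < 1`, `ρ_j ≤ c₁ϑ^j` ⟹ for SOME assignment `a K` per comparison, admissible at every level, road I's conclusion AT
SHARP CARRIERS: `ShellWeightBound l₀ T A B shA shB (K ↦ C′·ϑ^K)` with `C′ = 2((N₁+1)·ν̄·(C.toReal∕C⁻¹.toReal·(2F̄∕κ_min))·c₁·ϑ^{−N₁})`, the term weights and pieces being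
the `toReal`s of the transported masses — 18b's `shellWeightBound_geometric_of_selectedThresholds` with the pushes from `pushes_of_sandwich`. [folklore] -/
theorem shellWeightBound_geometric_of_transport {N₁ : ℕ} {νbar κmin c₁ ϑ : ℝ}
    (hw : ∀ K s, Measurable (w K s)) (hθ : ∀ j, 0 < θ j) (hκ : ∀ j, 0 < κ j ∧ κ j ≤ 1) (hρ : ∀ j, 0 ≤ ρ j ∧ ρ j < 1)
    (hdep : ∀ (K : ℕ) (s : σ) (a b : ℕ → ℝ), (∀ i, i < lvl K s → a i = b i) → ν₀ K a s = ν₀ K b s)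
    (hFbar : 0 ≤ Fbar) (hcard : ∀ K m, ((((SA K ∪ SB K).filter fun s => lvl K s = m).card : ℕ) : ℝ) ≤ Fbar) (hC : C ≠ ⊤) (hC0 : C ≠ 0)
    (hsand : ∀ (K : ℕ) (a : ℕ → ℝ), (∀ j, a j ∈ Icc ((1 - κ j) * θ j) (θ j)) → ∀ t, |t| ≤ l₀ → ∀ s ∈ SA K ∪ SB K,
      νt K a t s ≤ C • ν₀ K a s ∧ ν₀ K a s ≤ C • νt K a t s)
    (hRA : ∀ (K : ℕ) (a : ℕ → ℝ), (∀ j, a j ∈ Icc ((1 - κ j) * θ j) (θ j)) → ∀ t, |t| ≤ l₀ → ∀ τ ∈ T K,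
      0 ≤ shA K a t τ ∧ shA K a t τ ≤ (A' K a t τ).toReal ∧ shA K a t τ ≤ ∑ s ∈ SA K, (mA K a t s τ).toReal)
    (hpieceTA : ∀ (K : ℕ) (a : ℕ → ℝ), (∀ j, a j ∈ Icc ((1 - κ j) * θ j) (θ j)) → ∀ t, |t| ≤ l₀ → ∀ s ∈ SA K,
      ∑ τ ∈ T K, mA K a t s τ ≤ νt K a t s {x | a (lvl K s) * (1 - ρ (lvl K s)) ≤ w K s x ∧ w K s x < a (lvl K s)})
    (htotTA : ∀ (K : ℕ) (a : ℕ → ℝ), (∀ j, a j ∈ Icc ((1 - κ j) * θ j) (θ j)) → ∀ t, |t| ≤ l₀ → ∀ s ∈ SA K,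
      ∑ τ ∈ T K, A' K a t τ = νt K a t s univ)
    (hRB : ∀ (K : ℕ) (a : ℕ → ℝ), (∀ j, a j ∈ Icc ((1 - κ j) * θ j) (θ j)) → ∀ t, |t| ≤ l₀ → ∀ τ ∈ T K,
      0 ≤ shB K a t τ ∧ shB K a t τ ≤ (B' K a t τ).toReal ∧ shB K a t τ ≤ ∑ s ∈ SB K, (mB K a t s τ).toReal)
    (hpieceTB : ∀ (K : ℕ) (a : ℕ → ℝ), (∀ j, a j ∈ Icc ((1 - κ j) * θ j) (θ j)) → ∀ t, |t| ≤ l₀ → ∀ s ∈ SB K,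
      ∑ τ ∈ T K, mB K a t s τ ≤ νt K a t s {x | a (lvl K s) * (1 - ρ (lvl K s)) ≤ w K s x ∧ w K s x < a (lvl K s)})
    (htotTB : ∀ (K : ℕ) (a : ℕ → ℝ), (∀ j, a j ∈ Icc ((1 - κ j) * θ j) (θ j)) → ∀ t, |t| ≤ l₀ → ∀ s ∈ SB K,
      ∑ τ ∈ T K, B' K a t τ = νt K a t s univ)
    (hwinA : LiveWindow SA lvl N₁ νbar) (hwinB : LiveWindow SB lvl N₁ νbar)
    (hκmin : 0 < κmin) (hκminle : ∀ j, κmin ≤ κ j) (hρhalf : ∀ j, ρ j ≤ 1 / 2)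
    (hϑ0 : 0 < ϑ) (hϑ1 : ϑ < 1) (hrate : ∀ j, ρ j ≤ c₁ * ϑ ^ j) :
    ∃ a : ℕ → ℕ → ℝ, (∀ K j, a K j ∈ Icc ((1 - κ j) * θ j) (θ j)) ∧
      ShellWeightBound l₀ T (fun K t τ => (A' K (a K) t τ).toReal) (fun K t τ => (B' K (a K) t τ).toReal)
        (fun K => shA K (a K)) (fun K => shB K (a K))
        fun K => (2 * ((N₁ + 1) * νbar * (C.toReal / C⁻¹.toReal * (2 * Fbar / κmin)) * c₁ * ϑ⁻¹ ^ N₁)) * ϑ ^ K := by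
  have hle : ∀ K, ∀ s ∈ SA K ∪ SB K, lvl K s ≤ K := fun K s hs => by
    rcases Finset.mem_union.1 hs with h | h
    · exact hwinA.le_top K s h
    · exact hwinB.le_top K s h
  obtain ⟨hM₁, hM₂⟩ := lossPair_of_ne C hC hC0
  obtain ⟨a, hadm, hLA, hLB⟩ := levelLedgers_of_selectedThresholds_of_transport hw hθ hκ hρ hdep hFbar hcard hle hC hC0 hsand hRA
    hpieceTA htotTA hRB hpieceTB htotTB
  have hD : ∀ j, C.toReal / C⁻¹.toReal * (Fbar / ((1 - ρ j) * κ j)) ≤ C.toReal / C⁻¹.toReal * (2 * Fbar / κmin) := fun j =>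
    mul_le_mul_of_nonneg_left (levelConst_le hFbar (hρhalf j) hκmin (hκminle j)) (div_nonneg hM₁ hM₂.le)
  exact ⟨a, hadm, n21_knit_levels_geometric hLA hLB hwinA hwinB hD hD hϑ0 hϑ1 hrate hrate⟩

end PerComparison

/-! ## §3 The K5 stub at every SELECTED TRANSPORT reading -/

section AtCarriers

variable {N : ℕ} [NeZero N]

/-- **`S_N21` FOR EVERY SELECTED TRANSPORT READING.**  If every bundle `S` the reading predicate `SRec` pins carries: the slot bookkeeping of both runs on one
index type (families, levels, spaces, `t`-free measurable statistics, windows `θ_j, κ_j`, widths `ρ_j`, level count `F̄`), the LINEAGE data of NODE O's term object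
READ AT an admissible assignment `a K` per comparison — `t`-free finite state laws `ν₀ K s`, tilted finite laws `νt K t s`, one sandwich constant `C ≠ 0, ⊤`,
transported `ℝ≥0∞` pieces `mA∕mB` and weights `A′∕B′` with `hpieceT`∕`htotT`, shell letters with the (R) facts — the SELECTION CERTIFICATE at `a` (every slot
satisfies (M1) for `(ν₀, w)` at its level's threshold with `F̄∕((1−ρ)κ)` — 18b's `exists_goodAssignment` supplies it to whoever builds the reading), N20's live
windows, `κ_min`, `ρ_j ≤ ½`, N16's rate — such that the bundle's carriers ARE the transported masses (`S.A K t τ = (A′ K t τ).toReal`, …) and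
`S.Wsh ≥ 2((N₁+1)ν̄(C.toReal∕C⁻¹.toReal·2F̄∕κ_min)c₁ϑ^{−N₁})ϑ^K` is summable — then `S_N21 SRec`: 18b's `levelLedger_of_goodAssignment` ×2 with the pushes from
`pushes_of_sandwich`, then n21-a's `n21_knit_levels`.  NO push binder, NO (M1) binder. [folklore] -/
theorem s_N21_of_selectedTransportReading (SRec : SpineRecordPred N)
    (hread : ∀ (F : T4Continuum.T4Family) (D : YMDAG.UVSplit.Datum F N) (g₀ : ℕ → ℝ)
      (os : List (T4Continuum.ULoop F)) (S : SpineCarriers), SRec F D g₀ os S →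
      ∃ (σ : Type) (_dσ : DecidableEq σ) (X : ℕ → σ → Type) (_m : ∀ K s, MeasurableSpace (X K s))
        (SA SB : ℕ → Finset σ) (lvl : ℕ → σ → ℕ)
        (ν₀ : ∀ K : ℕ, ∀ s : σ, Measure (X K s)) (_f₀ : ∀ K s, IsFiniteMeasure (ν₀ K s))
        (νt : ∀ K : ℕ, ℝ → ∀ s : σ, Measure (X K s)) (_ft : ∀ K t s, IsFiniteMeasure (νt K t s))
        (w : ∀ (K : ℕ) (s : σ), X K s → ℝ) (θ κ ρ : ℕ → ℝ) (Fbar : ℝ) (D' : ℕ → ℝ) (C : ℝ≥0∞)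
        (A' B' : ℕ → ℝ → S.ι → ℝ≥0∞) (mA mB : ℕ → ℝ → σ → S.ι → ℝ≥0∞)
        (N₁ : ℕ) (νbar κmin c₁ ϑ : ℝ) (a : ℕ → ℕ → ℝ),
        -- signs, windows, widths, the level constant, the sandwich constant
        (∀ j, 0 ≤ ρ j) ∧ (∀ j, D' j = Fbar / ((1 - ρ j) * κ j)) ∧ 0 ≤ Fbar ∧ 0 < κmin ∧ (∀ j, κmin ≤ κ j) ∧ (∀ j, ρ j ≤ 1 / 2) ∧
        C ≠ ⊤ ∧ C ≠ 0 ∧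
        -- the admissible assignment and its selection certificate (both runs' slots) for the state laws
        (∀ K j, a K j ∈ Icc ((1 - κ j) * θ j) (θ j)) ∧
        (∀ K, ∀ s ∈ SA K ∪ SB K, SlotAntiConcentration (ν₀ K s) (w K s) (a K (lvl K s)) (ρ (lvl K s)) (D' (lvl K s))) ∧
        -- the carriers ARE the transported masses read at `a`
        (S.A = fun K t τ => (A' K t τ).toReal) ∧ (S.B = fun K t τ => (B' K t τ).toReal) ∧
        -- the sandwich at every live slot
        (∀ K t, |t| ≤ S.l₀ → ∀ s ∈ SA K ∪ SB K, νt K t s ≤ C • ν₀ K s ∧ ν₀ K s ≤ C • νt K t s) ∧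
        -- run A: (R), transported pieces and totals
        (∀ K t, |t| ≤ S.l₀ → ∀ τ ∈ S.T K, 0 ≤ S.shA K t τ ∧ S.shA K t τ ≤ (A' K t τ).toReal ∧
          S.shA K t τ ≤ ∑ s ∈ SA K, (mA K t s τ).toReal) ∧
        (∀ K t, |t| ≤ S.l₀ → ∀ s ∈ SA K,
          ∑ τ ∈ S.T K, mA K t s τ ≤ νt K t s {x | a K (lvl K s) * (1 - ρ (lvl K s)) ≤ w K s x ∧ w K s x < a K (lvl K s)}) ∧
        (∀ K t, |t| ≤ S.l₀ → ∀ s ∈ SA K, ∑ τ ∈ S.T K, A' K t τ = νt K t s univ) ∧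
        -- run B
        (∀ K t, |t| ≤ S.l₀ → ∀ τ ∈ S.T K, 0 ≤ S.shB K t τ ∧ S.shB K t τ ≤ (B' K t τ).toReal ∧
          S.shB K t τ ≤ ∑ s ∈ SB K, (mB K t s τ).toReal) ∧
        (∀ K t, |t| ≤ S.l₀ → ∀ s ∈ SB K,
          ∑ τ ∈ S.T K, mB K t s τ ≤ νt K t s {x | a K (lvl K s) * (1 - ρ (lvl K s)) ≤ w K s x ∧ w K s x < a K (lvl K s)}) ∧
        (∀ K t, |t| ≤ S.l₀ → ∀ s ∈ SB K, ∑ τ ∈ S.T K, B' K t τ = νt K t s univ) ∧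
        -- windows (N20), rate (N16), record weight
        LiveWindow SA lvl N₁ νbar ∧ LiveWindow SB lvl N₁ νbar ∧ 0 < ϑ ∧ ϑ < 1 ∧ (∀ j, ρ j ≤ c₁ * ϑ ^ j) ∧
        (∀ K, (2 * ((N₁ + 1) * νbar * (C.toReal / C⁻¹.toReal * (2 * Fbar / κmin)) * c₁ * ϑ⁻¹ ^ N₁)) * ϑ ^ K ≤ S.Wsh K) ∧ Summable S.Wsh) :
    S_N21 SRec := by
  intro F D g₀ os S hS
  obtain ⟨σ, _dσ, X, _m, SA, SB, lvl, ν₀, _f₀, νt, _ft, w, θ, κ, ρ, Fbar, D', C, A', B', mA, mB, N₁, νbar, κmin, c₁, ϑ, a,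
    hρ0, hD', hFbar, hκmin, hκminle, hρhalf, hC, hC0, hadm, hgood, hSA, hSB, hsand, hRA, hpieceTA, htotTA, hRB, hpieceTB, htotTB,
    hwinA, hwinB, hϑ0, hϑ1, hrate, hWsh, hsum⟩ := hread F D g₀ os S hS
  obtain ⟨hM₁, hM₂⟩ := lossPair_of_ne C hC hC0
  have hD'0 : ∀ j, 0 ≤ D' j := fun j => by
    rw [hD' j]
    have h1 : 0 < 1 - ρ j := by linarith [hρhalf j]
    have h2 : 0 < κ j := lt_of_lt_of_le hκmin (hκminle j)
    positivity
  -- 18b's one-run ledgers for the constant-in-`a` state laws, pushes from the sandwich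
  have hLA := levelLedger_of_goodAssignment (X := X) (ν := fun K _ s => ν₀ K s) (w := w) (lvl := lvl) (ρ := ρ) (l₀ := S.l₀) (T := S.T)
    (S := SA) (A := fun K _ t τ => (A' K t τ).toReal) (sh := fun K _ t τ => S.shA K t τ)
    (piece := fun K _ t s τ => (mA K t s τ).toReal) (M₁ := C.toReal) (M₂ := C⁻¹.toReal) (D' := D') a
    (fun K s hs => hgood K s (Finset.mem_union_left _ hs)) hD'0 hρ0 hM₁ hM₂
    (fun K t ht τ hτ => (hRA K t ht τ hτ).1) (fun K t ht τ hτ => (hRA K t ht τ hτ).2.1) (fun K t ht τ hτ => (hRA K t ht τ hτ).2.2)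
    (fun K t ht s hs =>
      (pushes_of_sandwich (S.T K) (ν₀ K s) (νt K t s) hC hC0 (hsand K t ht s (Finset.mem_union_left _ hs)).1
        (hsand K t ht s (Finset.mem_union_left _ hs)).2 (mA K t s) (A' K t) _ (hpieceTA K t ht s hs) (htotTA K t ht s hs)).1)
    (fun K t ht s hs =>
      (pushes_of_sandwich (S.T K) (ν₀ K s) (νt K t s) hC hC0 (hsand K t ht s (Finset.mem_union_left _ hs)).1
        (hsand K t ht s (Finset.mem_union_left _ hs)).2 (mA K t s) (A' K t) _ (hpieceTA K t ht s hs) (htotTA K t ht s hs)).2)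
  have hLB := levelLedger_of_goodAssignment (X := X) (ν := fun K _ s => ν₀ K s) (w := w) (lvl := lvl) (ρ := ρ) (l₀ := S.l₀) (T := S.T)
    (S := SB) (A := fun K _ t τ => (B' K t τ).toReal) (sh := fun K _ t τ => S.shB K t τ)
    (piece := fun K _ t s τ => (mB K t s τ).toReal) (M₁ := C.toReal) (M₂ := C⁻¹.toReal) (D' := D') a
    (fun K s hs => hgood K s (Finset.mem_union_right _ hs)) hD'0 hρ0 hM₁ hM₂
    (fun K t ht τ hτ => (hRB K t ht τ hτ).1) (fun K t ht τ hτ => (hRB K t ht τ hτ).2.1) (fun K t ht τ hτ => (hRB K t ht τ hτ).2.2)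
    (fun K t ht s hs =>
      (pushes_of_sandwich (S.T K) (ν₀ K s) (νt K t s) hC hC0 (hsand K t ht s (Finset.mem_union_right _ hs)).1
        (hsand K t ht s (Finset.mem_union_right _ hs)).2 (mB K t s) (B' K t) _ (hpieceTB K t ht s hs) (htotTB K t ht s hs)).1)
    (fun K t ht s hs =>
      (pushes_of_sandwich (S.T K) (ν₀ K s) (νt K t s) hC hC0 (hsand K t ht s (Finset.mem_union_right _ hs)).1
        (hsand K t ht s (Finset.mem_union_right _ hs)).2 (mB K t s) (B' K t) _ (hpieceTB K t ht s hs) (htotTB K t ht s hs)).2)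
  have hD : ∀ j, C.toReal / C⁻¹.toReal * D' j ≤ C.toReal / C⁻¹.toReal * (2 * Fbar / κmin) := fun j => by
    rw [hD' j]
    exact mul_le_mul_of_nonneg_left (levelConst_le hFbar (hρhalf j) hκmin (hκminle j)) (div_nonneg hM₁ hM₂.le)
  have h := n21_knit_levels hLA hLB hwinA hwinB hD hD hϑ0 hϑ1 hrate hrate hWsh hsum
  rw [hSA, hSB]
  exact h

end AtCarriers

end Summit.QuantumFields.YangMills.Theorems.N21SelectedThresholdsTransportLedgers

end
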